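import Mathlib
import Literature.MathematicalPhysics.QuantumFieldTheory.Balaban1983to89.B12Ext436Lattice
import Literature.MathematicalPhysics.QuantumFieldTheory.Balaban1983to89.B12Decay510R1

/-!
# B12 (4.36), (4.37) p.290–291 and (5.10) p.293 ON THE INFINITE CLASS 𝐃⁰_j WITH THE `r = 1` TERM OF (4.3) KEPT:
the full `n = 2` form of (4.3) p.281 (the `r = 2` Cauchy term of (4.35) PLUS the `r = 1` term on the `n(p) = 2` block)
over an abstract infinite `DomainClass` and on the concrete lattice ℤᵈ

[cite: Balaban1987RG1 = T. Bałaban, *Renormalization group approach to lattice gauge field theories. I. Generation of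
effective actions in a small field approximation and a coupling constant renormalization in four dimensions*, Commun.
Math. Phys. **109** (1987) 249–301; PDF page = journal page − 248; PDF held: `paper:balaban1987-cmp109-rg-i-small-field`.]
Companion modules (imported, none modified): `…Balaban1983to89.B12Ext436Lattice` (unit b03 gen 11: the concrete class
`latt d` of ℤᵈ, the site geometries `geomZ` / `geomZS`, every geometric leaf of `B12Ext436` discharged, the capstones
`ineq436_latt`, `twoPoint_latt`, `decay510_latt`, `…_lattS`, and `kernelBound_of_analytic` = the kernel bound of the
`r = 2` term (4.35) from the analytic leaves over an abstract infinite class), through it `…B12Ext436` (unit b03 gen 10: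
`DomainClass`, `SiteGeometry`, `KernelBound`, `GeomLeaf`, `CubeSumLeaf`, `FarLeaf`, `Ineq126`, (4.36)/(4.37)/(5.10)
on the infinite class from the named leaves); `…Balaban1983to89.B12Decay510R1` (unit b03 gen 4: `firstDeriv` = the
`r = 1` member of (4.3), its Cauchy estimate `norm_firstDeriv_le`, the vanishing mechanism (4.14) ⇒ (4.35), and the
robustness of (5.10) to the `r = 1` term — all over the FINITE systems `LocDomainSys` / `B12Decay510.SiteGeometry`).

## CITATION HEADER (verbatim quotations; every one is already carried, with the same locator, by an imported module —
`B12Decay510R1` for pp.281, 282, 284, 290 (4.35); `B12Ext436Lattice` / `B12Ext436` for pp.290 (4.36), 291, 293)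

* p. 281 [PDF 33] (4.3), first and second members: *"Differentiating the composite function on the right-hand
  side above n times with respect to B, we obtain the identities ⟨δⁿ/δBⁿ 𝐄^{(j)}(X, U_j(□₀, 1)), ⊗_{i=1}^n B_i⟩
  = Σ_{{1,…,n}=N(1)∪…∪N(r)} ⟨δʳ/δ𝐇ʳ 𝐄^{(j)}(X, 1), ⊗_{p=1}^r ⟨δ^{n(p)}/δB^{n(p)} 𝐇_j(□₀, 0), ⊗_{i∈N(p)} B_i⟩⟩
  = Σ ∂ʳ/(∂τ₁…∂τ_r) 𝐄^{(j)}(X, exp iξ Σ_{p=1}^r τ_p ⟨δ^{n(p)}/δB^{n(p)} 𝐇_j(□₀, 0), ⊗_{i∈N(p)} B_i⟩)∣_{τ=0} = …"* —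
  for n = 2 the set partitions of {1, 2} are {1}{2} (r = 2) and {1, 2} (r = 1, n(1) = 2): TWO terms.
* p. 282 [34]: *"The functional derivative (δ^{n(p)})/(δB^{n(p)})𝐇_j(□₀, 0) is given by a sum of several
  perturbative expressions discussed in Sect. G [15]. Each expression corresponds to a tree graph with n(p) initial
  points and one final point, and it has an exponential decay in a length of this graph. The derivative has an
  exponential decay in a length of a shortest tree graph of this type. The norm in (4.4) of the expression
  ⟨(δ^{n(p)}/δB^{n(p)})𝐇_j(□₀, 0), ⊗_{i∈N(p)}B_i⟩ can be estimated by B₃Π_{i∈N(p)}∣B_i∣, and if one of the functions B_i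
  is localized outside the domain X, then we have the additional exponential factor exp(−δ₀dist^{(ξ)}(X, supp B_i))."*
* p. 284 [36]: *"Thus we have the first, very important consequence of the gauge invariance (δ/δB)𝐄(1) = 0. (4.14)
  This equality simplifies the identities, and also the sum (4.6), we can drop the term with n = 1."*
* p. 290 [42]: *"For n = 2, and by the identity (4.14), the formula (4.3) yields 𝐄^{(2)}(X) = ⟨(δ²/δ𝐇²)𝐄(X, 1),
  H_j(□₀), H_j(□₀)⟩. (4.35)"*; *"We extend it to all X ∈ 𝐃⁰_j, where 𝐃⁰_j is the class of localization domains
  constructed for the lattice ξZ⁴. … (4.36) ∣Σ_{X∈𝐃⁰_j, X∩(□̃²)ᶜ≠∅} 𝐄^{(2)}_{μ,ν}(X, x, y)∣ ≤ O(1)E₀ exp(−(L^jη)^{−1})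
  exp(−δ₁∣x − y∣), for x ∈ □"*.  p. 291 [43]: *"(4.37) Π_{μ,ν}(x, y) = Σ_{X∈𝐃⁰_j} 𝐄^{(2)}_{μ,ν}(X, x, y)"*.
  p. 293 [45]: *"(5.10) … with a positive constant δ₁ determined by δ₀, κ, and M (e.g., δ₁ = 1/2min{δ₀, κM⁻¹})"*.

## WHAT IS TYPED HERE (kernel-checked; every analytic input a NAMED hypothesis, nothing of B12's analysis asserted)

The header of `B12Ext436Lattice` lists under NOT TYPED: *"the r = 1 term of (4.3) (handled for finite windows in
`B12Decay510R1`, not re-typed over the infinite class)"*.  This module types it.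
§1 OVER AN ABSTRACT INFINITE CLASS (`G : DomainClass`, `Γ : SiteGeometry G Λ`): `kernelBound_add` (two-sided kernel
bounds add), `kernelBound_rate_mono` (the rate δ₀ may be lowered), `kernelBound_r1` (the r = 1 term
Re ∂_τE_X(τ h⁽²⁾_X(x, y))∣₀ obeys `KernelBound` with C_E = E₀α₂⁻¹B₃′ — (4.4) analyticity on the α₂-ball, (1.18), the
Cauchy estimate `B12Decay510R1.norm_firstDeriv_le`, and the p. 282 bound for the block n(p) = 2 in its two-factor form
‖h⁽²⁾_X(x, y)‖ ≤ B₃′e^{−δ₀dist(x,X)}e^{−δ₀dist(y,X)}, one *"additional exponential factor"* per B_i = δ_x, δ_y),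
`kernelBound_of_repr43` (the FULL n = 2 form 𝐄²(X, x, y) = Re ∂²_{τ₁τ₂}E_X(τ₁h_X(x) + τ₂h_X(y))∣₀ + Re ∂_τE_X(τh⁽²⁾_X(x,
y))∣₀ ⇒ `KernelBound` with C_E = 4E₀α₂⁻²B₃² + E₀α₂⁻¹B₃′; the r = 2 part is `B12Ext436Lattice.kernelBound_of_analytic`),
`twoFactor_of_treeDecay` (p. 282 tree-graph decay ⇒ the two-factor form at rate δ₀/2), `kernelBound_of_repr43_tree`
(hence `KernelBound` at rate δ₀/2 from the literal tree-length decay), `repr435_of_repr43` (index-generic: the 𝐇-form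
`fderiv ℂ (E_X) 0 = 0` of (4.14) kills the r = 1 term in every direction, so the full form IS (4.35)), and the
capstones of `B12Ext436` with the r = 1 term kept: `twoPoint_delta1_of_repr43` ((4.37) converges absolutely and obeys
(5.10) with THE SAME printed δ₁ = ½ min{δ₀, κM⁻¹}; only the O(1) moves) and `ineq436_delta1_of_repr43` ((4.36)).
§2 ON THE CONCRETE LATTICE ℤᵈ (`latt d`, `geomZ d M` = ℓ¹ reading, `geomZS d M` = sup reading; d ≥ 1, M ≥ 1), every
geometric leaf discharged by `B12Ext436Lattice`: `twoPoint_latt_of_repr43`, `decay510_latt_of_repr43` (landing in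
`B12Sec2to5.Decay510` with C = (4E₀α₂⁻²B₃² + E₀α₂⁻¹B₃′) e^{3Mdδ₁} K₀(4·2ᵈ, 2d) K₁(d, δ₀/2), δ₁ = ½ min{δ₀, κ(Md)⁻¹} —
DIRECTLY on the infinite lattice, cf. `B12Decay510R1.decay510_window_r1` which needed exhausting windows and the limit
(5.1)), `ineq436_latt_of_repr43` ((4.36) for x ∈ □), `decay510_latt_of_repr43_tree` (the same from the literal
tree-length decay of p. 282, at δ₁ = ½ min{δ₀/2, κ(Md)⁻¹}), `decay510_latt_of_repr43_of_414` (under the 𝐇-form of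
(4.14) the conclusion is LITERALLY that of `B12Ext436Lattice.decay510_latt_of_analytic`: the n(p) = 2 block bound is not
needed and the constant is 4E₀α₂⁻²B₃²), and the sup-reading twin `twoPoint_lattS_of_repr43` (printed δ₁ on the nose).

## DICTIONARY / DIVERGENCE (cell DIVERGENCE.md D-b03.31; D-b03.13 and D-b03.30 apply unchanged)

(i) As in `B12Decay510R1` (D-b03.13): 𝐄²(X, x, y) is typed as the real part of the SUM of the two τ-derivative members
of (4.3) at n = 2 on abstract directions h_X(x) (image of ⟨δ𝐇_j(□₀,0)/δB, δ_x⟩) and h⁽²⁾_X(x, y) (image of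
⟨δ²𝐇_j(□₀,0)/δB², δ_x ⊗ δ_y⟩) in ONE complex normed space W for the whole class (as `B12Ext436Lattice` §4).
(ii) The p. 282 decay for n(p) = 2 is a HYPOTHESIS in two forms kept apart: the two-factor form `hh2` (the literal
sentence, one factor per B_i) and the tree-length form `hdec` + `hℓx`/`hℓy` (*"decay in a length of a shortest tree
graph"*, a tree through x, y and X being at least dist(x, X) and dist(y, X) long), the second implying the first at
half rate (`twoFactor_of_treeDecay`); neither is derived here ([15] Sect. G, cell GAPS G-B11-G2a).
(iii) (4.14) enters only as the 𝐇-form `fderiv ℂ (E_X) 0 = 0` (hypothesis `h414`), exactly as in `B12Decay510R1` (5).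
(iv) Lattice readings, constants c₁ = 3, K₀, K₁ and the budgets: those of `B12Ext436Lattice` (D-b03.30).

## NOT TYPED / NOT CLAIMED

The analytic leaves themselves ((4.4), (1.18), the responses h, h⁽²⁾ and their decay, (4.14) for 𝐄^{(j)}(X, ·)); that
the terms of (1.7) exist for the domains of the infinite lattice; the cubes □̃ⁿ and the partition ζ_□ of (3.4); the
replacement H_j(□₀) → H_j of p. 290.  This module is a kernel certificate that a located printed step ((4.35) ⇒ (4.36),
(4.37), (5.10) on 𝐃⁰_j) is robust to the unprinted use of (4.14) at n = 2, on the infinite lattice itself; it is NOT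
progress on any summit statement.
-/

namespace Literature.MathematicalPhysics.QuantumFieldTheory.Balaban1983to89.B12Ext436R1

open Literature.MathematicalPhysics.QuantumFieldTheory.Balaban1983to89
open Literature.MathematicalPhysics.QuantumFieldTheory.Balaban1983to89.B13ScaleTransfer (Pt)
open Literature.MathematicalPhysics.QuantumFieldTheory.Balaban1983to89.TreeLength (treeLen)
open Literature.MathematicalPhysics.QuantumFieldTheory.Balaban1983to89.B12TreeDecay (kappa₀ K₀ K₀_pos)
open Literature.MathematicalPhysics.QuantumFieldTheory.Balaban1983to89.B12Decay510
  (mixedDeriv delta1 delta1_nonneg delta1_mul_le delta1_le_half)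
open Literature.MathematicalPhysics.QuantumFieldTheory.Balaban1983to89.B12Decay510Window (K₁)
open Literature.MathematicalPhysics.QuantumFieldTheory.Balaban1983to89.B12Decay510R1
  (firstDeriv firstDeriv_zero norm_firstDeriv_le firstDeriv_eq_zero_of_fderiv_eq_zero)
open Literature.MathematicalPhysics.QuantumFieldTheory.Balaban1983to89.B12Sec2to5 (l1 Decay510)
open Literature.MathematicalPhysics.QuantumFieldTheory.Balaban1983to89.B12Ext436 (DomainClass SiteGeometry)
open Literature.MathematicalPhysics.QuantumFieldTheory.Balaban1983to89.B12Ext436Lattice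
open Set Metric Filter Topology

/-! ## 1. Over an abstract infinite class: the r = 1 term and the full n = 2 form of (4.3) -/

section Abstract

variable {G : DomainClass} {Λ : Type*} (Γ : SiteGeometry G Λ)
variable {W : Type*} [NormedAddCommGroup W] [NormedSpace ℂ W]

/-- Two-sided kernel bounds over the infinite class add: `KernelBound` for T₁ with C₁ and for T₂ with C₂ (same rates)
⇒ for T₁ + T₂ with C₁ + C₂ (the ∞-analogue of `B12Decay510R1.kernelBound_add`). [folklore] -/
theorem kernelBound_add {T₁ T₂ : G.Dom → Λ → Λ → ℝ} {C₁ C₂ κ δ₀ : ℝ}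
    (h₁ : Γ.KernelBound T₁ C₁ κ δ₀) (h₂ : Γ.KernelBound T₂ C₂ κ δ₀) :
    Γ.KernelBound (fun X x y => T₁ X x y + T₂ X x y) (C₁ + C₂) κ δ₀ := by
  intro X x y
  have e1 := h₁ X x y
  have e2 := h₂ X x y
  calc |T₁ X x y + T₂ X x y| ≤ |T₁ X x y| + |T₂ X x y| := abs_add_le _ _
    _ ≤ C₁ * Real.exp (-κ * G.dj X) * Real.exp (-δ₀ * Γ.distD x X) * Real.exp (-δ₀ * Γ.distD y X) +
          C₂ * Real.exp (-κ * G.dj X) * Real.exp (-δ₀ * Γ.distD x X) * Real.exp (-δ₀ * Γ.distD y X) :=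
        add_le_add e1 e2
    _ = (C₁ + C₂) * Real.exp (-κ * G.dj X) * Real.exp (-δ₀ * Γ.distD x X) * Real.exp (-δ₀ * Γ.distD y X) := by
        ring

/-- The site rate of a two-sided kernel bound may be lowered (C_E ≥ 0, 0 ≤ δ₀′ ≤ δ₀; dist(·, X) ≥ 0). [folklore] -/
theorem kernelBound_rate_mono {T : G.Dom → Λ → Λ → ℝ} {C κ δ₀ δ₀' : ℝ} (hC : 0 ≤ C)
    (h : Γ.KernelBound T C κ δ₀) (hle : δ₀' ≤ δ₀) :
    Γ.KernelBound T C κ δ₀' := by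
  intro X x y
  have hx : Real.exp (-δ₀ * Γ.distD x X) ≤ Real.exp (-δ₀' * Γ.distD x X) :=
    Real.exp_le_exp.2 (by nlinarith [Γ.distD_nonneg x X])
  have hy : Real.exp (-δ₀ * Γ.distD y X) ≤ Real.exp (-δ₀' * Γ.distD y X) :=
    Real.exp_le_exp.2 (by nlinarith [Γ.distD_nonneg y X])
  have h0 : 0 ≤ C * Real.exp (-κ * G.dj X) := mul_nonneg hC (Real.exp_nonneg _)
  calc |T X x y| ≤ C * Real.exp (-κ * G.dj X) * Real.exp (-δ₀ * Γ.distD x X) * Real.exp (-δ₀ * Γ.distD y X) :=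
        h X x y
    _ ≤ C * Real.exp (-κ * G.dj X) * Real.exp (-δ₀' * Γ.distD x X) * Real.exp (-δ₀' * Γ.distD y X) :=
        mul_le_mul (mul_le_mul_of_nonneg_left hx h0) hy (Real.exp_nonneg _)
          (mul_nonneg h0 (Real.exp_nonneg _))

/-- **The r = 1 term of (4.3) obeys the two-sided kernel bound over the infinite class**: for E_X analytic on the
(4.4)-ball of radius α₂ and bounded by E₀e^{−κd_j(X)} there ((1.18)), and the n(p) = 2 block direction bounded in the
two-factor form of p. 282, ‖h⁽²⁾_X(x, y)‖ ≤ B₃′e^{−δ₀dist(x,X)}e^{−δ₀dist(y,X)} (*"the additional exponential factor"*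
for each of B₁ = δ_x, B₂ = δ_y localized outside X), the term Re ∂_τE_X(τh⁽²⁾_X(x, y))∣₀ satisfies `KernelBound` with
C_E = E₀α₂⁻¹B₃′ (the Cauchy estimate `B12Decay510R1.norm_firstDeriv_le`; the ∞-analogue of
`B12Decay510R1.kernelBound_r1`). [cite: Balaban1987RG1, (4.3)-(4.5) pp.281-282] -/
theorem kernelBound_r1 (EX : G.Dom → W → ℂ) (h2 : G.Dom → Λ → Λ → W)
    {α₂ E₀ κ B₃' δ₀ : ℝ} (hα₂ : 0 < α₂) (han : ∀ X, AnalyticOnNhd ℂ (EX X) (ball 0 α₂))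
    (h118 : ∀ X, ∀ v ∈ ball (0 : W) α₂, ‖EX X v‖ ≤ E₀ * Real.exp (-κ * G.dj X))
    (hh2 : ∀ X x y, ‖h2 X x y‖ ≤ B₃' * Real.exp (-δ₀ * Γ.distD x X) * Real.exp (-δ₀ * Γ.distD y X)) :
    Γ.KernelBound (fun X x y => (firstDeriv (EX X) (h2 X x y)).re) (E₀ / α₂ * B₃') κ δ₀ := by
  intro X x y
  have hS0 : 0 ≤ E₀ * Real.exp (-κ * G.dj X) := (norm_nonneg _).trans (h118 X 0 (mem_ball_self hα₂))
  show |(firstDeriv (EX X) (h2 X x y)).re| ≤ _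
  calc |(firstDeriv (EX X) (h2 X x y)).re| ≤ ‖firstDeriv (EX X) (h2 X x y)‖ := Complex.abs_re_le_norm _
    _ ≤ E₀ * Real.exp (-κ * G.dj X) / α₂ * ‖h2 X x y‖ := norm_firstDeriv_le hα₂ (han X) (h118 X) _
    _ ≤ E₀ * Real.exp (-κ * G.dj X) / α₂ *
          (B₃' * Real.exp (-δ₀ * Γ.distD x X) * Real.exp (-δ₀ * Γ.distD y X)) :=
        mul_le_mul_of_nonneg_left (hh2 X x y) (div_nonneg hS0 hα₂.le)
    _ = E₀ / α₂ * B₃' * Real.exp (-κ * G.dj X) * Real.exp (-δ₀ * Γ.distD x X) *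
          Real.exp (-δ₀ * Γ.distD y X) := by ring

/-- **The two-sided kernel bound over the infinite class from the FULL n = 2 form of (4.3)**: 𝐄²(X, x, y) =
Re ∂²_{τ₁τ₂}E_X(τ₁h_X(x) + τ₂h_X(y))∣₀ + Re ∂_τE_X(τh⁽²⁾_X(x, y))∣₀ (`hrepr`; the r = 2 and r = 1 terms), E_X analytic
on (4.4) with (1.18), the p. 282 bounds ‖h_X(x)‖ ≤ B₃e^{−δ₀dist(x,X)} (n(p) = 1) and ‖h⁽²⁾_X(x, y)‖ ≤
B₃′e^{−δ₀dist(x,X)}e^{−δ₀dist(y,X)} (n(p) = 2) ⇒ `KernelBound` with C_E = 4E₀α₂⁻²B₃² + E₀α₂⁻¹B₃′ (r = 2 part: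
`B12Ext436Lattice.kernelBound_of_analytic`; the ∞-analogue of `B12Decay510R1.kernelBound_of_repr43`).
[cite: Balaban1987RG1, (4.3)-(4.5) pp.281-282 and (4.35) p.290] -/
theorem kernelBound_of_repr43 (EX : G.Dom → W → ℂ) (h : G.Dom → Λ → W) (h2 : G.Dom → Λ → Λ → W)
    (E2 : G.Dom → Λ → Λ → ℝ) {α₂ E₀ B₃ B₃' κ δ₀ : ℝ} (hα₂ : 0 < α₂) (hE₀ : 0 ≤ E₀) (hB₃ : 0 ≤ B₃)
    (han : ∀ X, AnalyticOnNhd ℂ (EX X) (ball 0 α₂))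
    (h118 : ∀ X, ∀ v ∈ ball (0 : W) α₂, ‖EX X v‖ ≤ E₀ * Real.exp (-κ * G.dj X))
    (hrepr : ∀ X x y, E2 X x y =
      (mixedDeriv (EX X) (h X x) (h X y)).re + (firstDeriv (EX X) (h2 X x y)).re)
    (hh : ∀ X x, ‖h X x‖ ≤ B₃ * Real.exp (-δ₀ * Γ.distD x X))
    (hh2 : ∀ X x y, ‖h2 X x y‖ ≤ B₃' * Real.exp (-δ₀ * Γ.distD x X) * Real.exp (-δ₀ * Γ.distD y X)) :
    Γ.KernelBound E2 (4 * E₀ / α₂ ^ 2 * B₃ ^ 2 + E₀ / α₂ * B₃') κ δ₀ := by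
  have k2 : Γ.KernelBound (fun X x y => (mixedDeriv (EX X) (h X x) (h X y)).re)
      (4 * E₀ / α₂ ^ 2 * B₃ ^ 2) κ δ₀ :=
    kernelBound_of_analytic Γ EX h (fun X x y => (mixedDeriv (EX X) (h X x) (h X y)).re) hα₂ hE₀ hB₃ han h118
      (fun _ _ _ => rfl) hh
  have k1 := kernelBound_r1 Γ EX h2 hα₂ han h118 hh2
  have k := kernelBound_add Γ k2 k1
  intro X x y
  rw [hrepr]
  exact k X x y

omit [NormedSpace ℂ W] in
/-- **p. 282, n(p) = 2: tree-graph decay ⇒ one factor per B_i at half rate, over the infinite class.**  IF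
‖h⁽²⁾_X(x, y)‖ ≤ B e^{−δ₀ℓ_X(x,y)}, ℓ_X(x, y) the length of a (shortest) tree graph with initial points x, y and final
point in X (*"it has an exponential decay in a length of this graph … of a shortest tree graph of this type"*), and
such a graph is at least dist(x, X) and at least dist(y, X) long (`hℓx`, `hℓy`), THEN ‖h⁽²⁾_X(x, y)‖ ≤
B e^{−(δ₀/2)dist(x,X)} e^{−(δ₀/2)dist(y,X)} (the ∞-analogue of `B12Decay510R1.twoFactor_of_treeDecay`).
[cite: Balaban1987RG1, p.282] -/
theorem twoFactor_of_treeDecay (h2 : G.Dom → Λ → Λ → W) (ℓ : G.Dom → Λ → Λ → ℝ)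
    {B δ₀ : ℝ} (hB : 0 ≤ B) (hδ₀ : 0 ≤ δ₀) (hℓx : ∀ X x y, Γ.distD x X ≤ ℓ X x y)
    (hℓy : ∀ X x y, Γ.distD y X ≤ ℓ X x y) (hdec : ∀ X x y, ‖h2 X x y‖ ≤ B * Real.exp (-δ₀ * ℓ X x y))
    (X : G.Dom) (x y : Λ) :
    ‖h2 X x y‖ ≤ B * Real.exp (-(δ₀ / 2) * Γ.distD x X) * Real.exp (-(δ₀ / 2) * Γ.distD y X) := by
  have hsum : -δ₀ * ℓ X x y ≤ -(δ₀ / 2) * Γ.distD x X + -(δ₀ / 2) * Γ.distD y X := by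
    nlinarith [hℓx X x y, hℓy X x y, hδ₀]
  calc ‖h2 X x y‖ ≤ B * Real.exp (-δ₀ * ℓ X x y) := hdec X x y
    _ ≤ B * Real.exp (-(δ₀ / 2) * Γ.distD x X + -(δ₀ / 2) * Γ.distD y X) :=
        mul_le_mul_of_nonneg_left (Real.exp_le_exp.mpr hsum) hB
    _ = B * Real.exp (-(δ₀ / 2) * Γ.distD x X) * Real.exp (-(δ₀ / 2) * Γ.distD y X) := by
        rw [Real.exp_add]; ring

/-- **`KernelBound` at rate δ₀/2 from the literal tree-length decay of p. 282** (n(p) = 1 responses at rate δ₀,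
lowered to δ₀/2 by `kernelBound_rate_mono`; n(p) = 2 block in the tree-length form, put in two-factor form at δ₀/2 by
`twoFactor_of_treeDecay`): the full n = 2 form of (4.3) obeys `KernelBound` with C_E = 4E₀α₂⁻²B₃² + E₀α₂⁻¹B and site
rate δ₀/2. [cite: Balaban1987RG1, (4.3)-(4.5) pp.281-282] -/
theorem kernelBound_of_repr43_tree (EX : G.Dom → W → ℂ) (h : G.Dom → Λ → W) (h2 : G.Dom → Λ → Λ → W)
    (E2 : G.Dom → Λ → Λ → ℝ) (ℓ : G.Dom → Λ → Λ → ℝ) {α₂ E₀ B₃ B κ δ₀ : ℝ} (hα₂ : 0 < α₂) (hE₀ : 0 ≤ E₀)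
    (hB₃ : 0 ≤ B₃) (hB : 0 ≤ B) (hδ₀ : 0 ≤ δ₀)
    (han : ∀ X, AnalyticOnNhd ℂ (EX X) (ball 0 α₂))
    (h118 : ∀ X, ∀ v ∈ ball (0 : W) α₂, ‖EX X v‖ ≤ E₀ * Real.exp (-κ * G.dj X))
    (hrepr : ∀ X x y, E2 X x y =
      (mixedDeriv (EX X) (h X x) (h X y)).re + (firstDeriv (EX X) (h2 X x y)).re)
    (hh : ∀ X x, ‖h X x‖ ≤ B₃ * Real.exp (-δ₀ * Γ.distD x X))
    (hℓx : ∀ X x y, Γ.distD x X ≤ ℓ X x y) (hℓy : ∀ X x y, Γ.distD y X ≤ ℓ X x y)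
    (hdec : ∀ X x y, ‖h2 X x y‖ ≤ B * Real.exp (-δ₀ * ℓ X x y)) :
    Γ.KernelBound E2 (4 * E₀ / α₂ ^ 2 * B₃ ^ 2 + E₀ / α₂ * B) κ (δ₀ / 2) := by
  have k2 : Γ.KernelBound (fun X x y => (mixedDeriv (EX X) (h X x) (h X y)).re)
      (4 * E₀ / α₂ ^ 2 * B₃ ^ 2) κ (δ₀ / 2) :=
    kernelBound_rate_mono Γ (by positivity)
      (kernelBound_of_analytic Γ EX h (fun X x y => (mixedDeriv (EX X) (h X x) (h X y)).re) hα₂ hE₀ hB₃ han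
        h118 (fun _ _ _ => rfl) hh) (by linarith)
  have k1 := kernelBound_r1 Γ EX h2 hα₂ han h118 (twoFactor_of_treeDecay Γ h2 ℓ hB hδ₀ hℓx hℓy hdec)
  have k := kernelBound_add Γ k2 k1
  intro X x y
  rw [hrepr]
  exact k X x y

/-- **(4.14) ⇒ (4.35), index-generic** (the form of `B12Decay510R1.repr435_of_repr43` for ANY index type of domains,
in particular the infinite class): under the 𝐇-form `fderiv ℂ (E_X) 0 = 0` of (4.14) for the analytic E_X, the full
n = 2 form of (4.3) IS the printed (4.35) form 𝐄²(X, x, y) = Re ∂²_{τ₁τ₂}E_X(τ₁h_X(x) + τ₂h_X(y))∣₀.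
[cite: Balaban1987RG1, (4.14) p.284 and (4.35) p.290] -/
theorem repr435_of_repr43 {ι : Type*} (EX : ι → W → ℂ) (h : ι → Λ → W) (h2 : ι → Λ → Λ → W)
    (E2 : ι → Λ → Λ → ℝ) {α₂ : ℝ} (hα₂ : 0 < α₂) (han : ∀ X, AnalyticOnNhd ℂ (EX X) (ball 0 α₂))
    (h414 : ∀ X, fderiv ℂ (EX X) 0 = 0)
    (hrepr : ∀ X x y, E2 X x y =
      (mixedDeriv (EX X) (h X x) (h X y)).re + (firstDeriv (EX X) (h2 X x y)).re) :
    ∀ X x y, E2 X x y = (mixedDeriv (EX X) (h X x) (h X y)).re := by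
  intro X x y
  have hd : DifferentiableAt ℂ (EX X) 0 := (han X 0 (mem_ball_self hα₂)).differentiableAt
  rw [hrepr, firstDeriv_eq_zero_of_fderiv_eq_zero hd (h414 X), Complex.zero_re, add_zero]

/-- **(4.37)/(5.10) on the infinite class with the r = 1 term KEPT** (the ∞-analogue of
`B12Decay510R1.abs_twoPoint_le_of_repr43`): the full n = 2 representation, the analytic leaves, the p. 282 bounds for
n(p) = 1, 2, the geometry and cube-sum leaves and (1.26) at rate κ/2 ⇒ X ↦ 𝐄²(X, x, y) is summable over the whole
class and ∣Π(x, y)∣ ≤ (4E₀α₂⁻²B₃² + E₀α₂⁻¹B₃′) e^{δ₁Mc₁} K₀K₁ e^{−δ₁∣x − y∣} with THE SAME printed δ₁ = ½ min{δ₀, κM⁻¹}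
(`B12Ext436.SiteGeometry.twoPoint_delta1`) — only the O(1) of (5.10) moves. [cite: Balaban1987RG1, (4.37) p.291 and (5.10) p.293] -/
theorem twoPoint_delta1_of_repr43 {ρ : Λ → Λ → ℝ} (EX : G.Dom → W → ℂ) (h : G.Dom → Λ → W)
    (h2 : G.Dom → Λ → Λ → W) (E2 : G.Dom → Λ → Λ → ℝ) {α₂ E₀ B₃ B₃' κ δ₀ M c₁ K₀ K₁ : ℝ}
    (hα₂ : 0 < α₂) (hE₀ : 0 ≤ E₀) (hB₃ : 0 ≤ B₃) (hB₃' : 0 ≤ B₃') (hK₀ : 0 ≤ K₀) (hδ₀ : 0 ≤ δ₀) (hκ : 0 ≤ κ)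
    (hM : 0 < M) (han : ∀ X, AnalyticOnNhd ℂ (EX X) (ball 0 α₂))
    (h118 : ∀ X, ∀ v ∈ ball (0 : W) α₂, ‖EX X v‖ ≤ E₀ * Real.exp (-κ * G.dj X))
    (hrepr : ∀ X x y, E2 X x y =
      (mixedDeriv (EX X) (h X x) (h X y)).re + (firstDeriv (EX X) (h2 X x y)).re)
    (hh : ∀ X x, ‖h X x‖ ≤ B₃ * Real.exp (-δ₀ * Γ.distD x X))
    (hh2 : ∀ X x y, ‖h2 X x y‖ ≤ B₃' * Real.exp (-δ₀ * Γ.distD x X) * Real.exp (-δ₀ * Γ.distD y X))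
    (hgeo : Γ.GeomLeaf ρ M c₁) (hcube : Γ.CubeSumLeaf (δ₀ / 2) K₁) (htree : G.Ineq126 (κ / 2) K₀) (x y : Λ) :
    Summable (fun X : G.Dom => E2 X x y) ∧
    |∑' X, E2 X x y| ≤ (4 * E₀ / α₂ ^ 2 * B₃ ^ 2 + E₀ / α₂ * B₃') * Real.exp (delta1 δ₀ κ M * M * c₁) * K₀ *
      K₁ * Real.exp (-(delta1 δ₀ κ M) * ρ x y) :=
  Γ.twoPoint_delta1 (by positivity) hK₀ hδ₀ hκ hM
    (kernelBound_of_repr43 Γ EX h h2 E2 hα₂ hE₀ hB₃ han h118 hrepr hh hh2) hgeo hcube htree x y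

/-- **(4.36) on the infinite class with the r = 1 term KEPT**: for x ∈ □ (`Box`) the family over {X : Far X} is
summable and ∣Σ_{X : Far} 𝐄²(X, x, y)∣ ≤ (4E₀α₂⁻²B₃² + E₀α₂⁻¹B₃′) e^{δ₁Mc₁} K₀K₁ · e^{−(δ₁/2)R} · e^{−δ₁∣x − y∣}, δ₁ =
½ min{δ₀, κM⁻¹} (domain count at κ/4, cube sum at δ₀/4; `B12Ext436.SiteGeometry.ineq436_delta1`).
[cite: Balaban1987RG1, (4.36) p.290] -/
theorem ineq436_delta1_of_repr43 {ρ : Λ → Λ → ℝ} (EX : G.Dom → W → ℂ) (h : G.Dom → Λ → W)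
    (h2 : G.Dom → Λ → Λ → W) (E2 : G.Dom → Λ → Λ → ℝ) {α₂ E₀ B₃ B₃' κ δ₀ M c₁ K₀ K₁ R : ℝ}
    {Far : G.Dom → Prop} {Box : Set Λ}
    (hα₂ : 0 < α₂) (hE₀ : 0 ≤ E₀) (hB₃ : 0 ≤ B₃) (hB₃' : 0 ≤ B₃') (hK₀ : 0 ≤ K₀) (hδ₀ : 0 ≤ δ₀) (hκ : 0 ≤ κ)
    (hM : 0 < M) (han : ∀ X, AnalyticOnNhd ℂ (EX X) (ball 0 α₂))
    (h118 : ∀ X, ∀ v ∈ ball (0 : W) α₂, ‖EX X v‖ ≤ E₀ * Real.exp (-κ * G.dj X))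
    (hrepr : ∀ X x y, E2 X x y =
      (mixedDeriv (EX X) (h X x) (h X y)).re + (firstDeriv (EX X) (h2 X x y)).re)
    (hh : ∀ X x, ‖h X x‖ ≤ B₃ * Real.exp (-δ₀ * Γ.distD x X))
    (hh2 : ∀ X x y, ‖h2 X x y‖ ≤ B₃' * Real.exp (-δ₀ * Γ.distD x X) * Real.exp (-δ₀ * Γ.distD y X))
    (hgeo : Γ.GeomLeaf ρ M c₁) (hcube : Γ.CubeSumLeaf (δ₀ / 4) K₁) (htree : G.Ineq126 (κ / 4) K₀)
    (hfar : Γ.FarLeaf Far Box M R) {x : Λ} (hx : x ∈ Box) (y : Λ) :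
    Summable (fun X : {X : G.Dom // Far X} => E2 X.1 x y) ∧
    |∑' X : {X : G.Dom // Far X}, E2 X.1 x y| ≤
      (4 * E₀ / α₂ ^ 2 * B₃ ^ 2 + E₀ / α₂ * B₃') * Real.exp (delta1 δ₀ κ M * M * c₁) * K₀ * K₁ *
        Real.exp (-(delta1 δ₀ κ M / 2) * R) * Real.exp (-(delta1 δ₀ κ M) * ρ x y) :=
  Γ.ineq436_delta1 (by positivity) hK₀ hδ₀ hκ hM
    (kernelBound_of_repr43 Γ EX h h2 E2 hα₂ hE₀ hB₃ han h118 hrepr hh hh2) hgeo hcube htree hfar hx y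

end Abstract

/-! ## 2. On the concrete lattice ℤᵈ: (4.36), (4.37), (5.10) with the r = 1 term kept -/

section Lattice

variable {d : ℕ} {W : Type*} [NormedAddCommGroup W] [NormedSpace ℂ W]

/-- **(4.37) converges absolutely on 𝐃⁰_j of ℤᵈ and obeys (5.10) with the r = 1 term KEPT** (ℓ¹ reading, cubes of
side M ≥ 1, d ≥ 1, every geometric leaf discharged): the full n = 2 form of (4.3), the analytic leaves (4.4)/(1.18),
the p. 282 bounds for n(p) = 1 and n(p) = 2 with δ₀ > 0, and κ ≥ 2κ₀(4·2ᵈ, 2d) ⇒ for all sites x, y the family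
X ↦ 𝐄²(X, x, y) is summable and ∣Π(x, y)∣ ≤ (4E₀α₂⁻²B₃² + E₀α₂⁻¹B₃′) e^{3Mdδ₁} K₀(4·2ᵈ, 2d) K₁(d, δ₀/2) e^{−δ₁∣x − y∣₁},
δ₁ = ½ min{δ₀, κ(Md)⁻¹}. [cite: Balaban1987RG1, (4.37) p.291 and (5.10) p.293] -/
theorem twoPoint_latt_of_repr43 (hd : 0 < d) {M : ℕ} (hM : 0 < M) (EX : LDom d → W → ℂ) (h : LDom d → Pt d → W)
    (h2 : LDom d → Pt d → Pt d → W) (E2 : LDom d → Pt d → Pt d → ℝ) {α₂ E₀ B₃ B₃' κ δ₀ : ℝ}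
    (hα₂ : 0 < α₂) (hE₀ : 0 ≤ E₀) (hB₃ : 0 ≤ B₃) (hB₃' : 0 ≤ B₃') (hδ₀ : 0 < δ₀)
    (hκ₀ : kappa₀ (4 * 2 ^ d) (2 * d) ≤ κ / 2)
    (han : ∀ X, AnalyticOnNhd ℂ (EX X) (ball 0 α₂))
    (h118 : ∀ X, ∀ v ∈ ball (0 : W) α₂, ‖EX X v‖ ≤ E₀ * Real.exp (-κ * treeLen X.1))
    (hrepr : ∀ X x y, E2 X x y =
      (mixedDeriv (EX X) (h X x) (h X y)).re + (firstDeriv (EX X) (h2 X x y)).re)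
    (hh : ∀ X x, ‖h X x‖ ≤ B₃ * Real.exp (-δ₀ * (geomZ d M).distD x X))
    (hh2 : ∀ X x y, ‖h2 X x y‖ ≤
      B₃' * Real.exp (-δ₀ * (geomZ d M).distD x X) * Real.exp (-δ₀ * (geomZ d M).distD y X)) (x y : Pt d) :
    Summable (fun X : LDom d => E2 X x y) ∧
    |∑' X : LDom d, E2 X x y| ≤
      (4 * E₀ / α₂ ^ 2 * B₃ ^ 2 + E₀ / α₂ * B₃') * Real.exp (delta1 δ₀ κ ((M : ℝ) * d) * ((M : ℝ) * d) * 3) *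
        K₀ (4 * 2 ^ d) (2 * d) * K₁ d (δ₀ / 2) * Real.exp (-(delta1 δ₀ κ ((M : ℝ) * d)) * l1 (x - y)) :=
  twoPoint_latt hd hM (by positivity) hδ₀ hκ₀
    (kernelBound_of_repr43 (geomZ d M) EX h h2 E2 hα₂ hE₀ hB₃ han h118 hrepr hh hh2) x y

/-- **(5.10) ON ℤᵈ with the r = 1 term KEPT, in the lineage's typed form, DIRECTLY on the infinite lattice** (no
window limit; cf. `B12Decay510R1.decay510_window_r1`): under the hypotheses of `twoPoint_latt_of_repr43`, (4.37)
converges absolutely for all x, y and Π(z) := Σ′_{X∈𝐃⁰_j} 𝐄²(X, 0, z) satisfies `Decay510 Π C δ₁` with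
C = (4E₀α₂⁻²B₃² + E₀α₂⁻¹B₃′) e^{3Mdδ₁} K₀(4·2ᵈ, 2d) K₁(d, δ₀/2), δ₁ = ½ min{δ₀, κ(Md)⁻¹} — the constant of
`B12Ext436Lattice.decay510_latt_of_analytic` enlarged by E₀α₂⁻¹B₃′, the rate unchanged. [cite: Balaban1987RG1, (5.10) p.293] -/
theorem decay510_latt_of_repr43 (hd : 0 < d) {M : ℕ} (hM : 0 < M) (EX : LDom d → W → ℂ) (h : LDom d → Pt d → W)
    (h2 : LDom d → Pt d → Pt d → W) (E2 : LDom d → Pt d → Pt d → ℝ) {α₂ E₀ B₃ B₃' κ δ₀ : ℝ}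
    (hα₂ : 0 < α₂) (hE₀ : 0 ≤ E₀) (hB₃ : 0 ≤ B₃) (hB₃' : 0 ≤ B₃') (hδ₀ : 0 < δ₀)
    (hκ₀ : kappa₀ (4 * 2 ^ d) (2 * d) ≤ κ / 2)
    (han : ∀ X, AnalyticOnNhd ℂ (EX X) (ball 0 α₂))
    (h118 : ∀ X, ∀ v ∈ ball (0 : W) α₂, ‖EX X v‖ ≤ E₀ * Real.exp (-κ * treeLen X.1))
    (hrepr : ∀ X x y, E2 X x y =
      (mixedDeriv (EX X) (h X x) (h X y)).re + (firstDeriv (EX X) (h2 X x y)).re)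
    (hh : ∀ X x, ‖h X x‖ ≤ B₃ * Real.exp (-δ₀ * (geomZ d M).distD x X))
    (hh2 : ∀ X x y, ‖h2 X x y‖ ≤
      B₃' * Real.exp (-δ₀ * (geomZ d M).distD x X) * Real.exp (-δ₀ * (geomZ d M).distD y X)) :
    (∀ x y, Summable (fun X : LDom d => E2 X x y)) ∧
    Decay510 (fun z => ∑' X : LDom d, E2 X 0 z)
      ((4 * E₀ / α₂ ^ 2 * B₃ ^ 2 + E₀ / α₂ * B₃') * Real.exp (delta1 δ₀ κ ((M : ℝ) * d) * ((M : ℝ) * d) * 3) *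
        K₀ (4 * 2 ^ d) (2 * d) * K₁ d (δ₀ / 2))
      (delta1 δ₀ κ ((M : ℝ) * d)) := by
  have hE : (geomZ d M).KernelBound E2 (4 * E₀ / α₂ ^ 2 * B₃ ^ 2 + E₀ / α₂ * B₃') κ δ₀ :=
    kernelBound_of_repr43 (geomZ d M) EX h h2 E2 hα₂ hE₀ hB₃ han h118 hrepr hh hh2
  have hCE : 0 ≤ 4 * E₀ / α₂ ^ 2 * B₃ ^ 2 + E₀ / α₂ * B₃' := by positivity
  exact ⟨fun x y => (twoPoint_latt hd hM hCE hδ₀ hκ₀ hE x y).1, decay510_latt hd hM hCE hδ₀ hκ₀ hE⟩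

/-- **(4.36) ON ℤᵈ with the r = 1 term KEPT** (ℓ¹ reading): □ = `Box` and (□̃²)ᶜ = `Outer` any sets of sites with
R ≤ ∣x − q∣₁ for x ∈ □, q ∈ (□̃²)ᶜ; the full n = 2 form, the analytic leaves, the p. 282 bounds with δ₀ > 0, and
κ ≥ 4κ₀(4·2ᵈ, 2d) ⇒ for x ∈ □ the family over {X ∈ 𝐃⁰_j : X∩(□̃²)ᶜ ≠ ∅} is summable and ∣Σ∣ ≤
(4E₀α₂⁻²B₃² + E₀α₂⁻¹B₃′) e^{3Mdδ₁} K₀(4·2ᵈ, 2d) K₁(d, δ₀/4) · e^{−(δ₁/2)(R − 3Md)} · e^{−δ₁∣x − y∣₁}, δ₁ = ½ min{δ₀, κ(Md)⁻¹}.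
[cite: Balaban1987RG1, (4.36) p.290] -/
theorem ineq436_latt_of_repr43 (hd : 0 < d) {M : ℕ} (hM : 0 < M) (EX : LDom d → W → ℂ) (h : LDom d → Pt d → W)
    (h2 : LDom d → Pt d → Pt d → W) (E2 : LDom d → Pt d → Pt d → ℝ) {α₂ E₀ B₃ B₃' κ δ₀ R : ℝ}
    {Box Outer : Set (Pt d)} (hα₂ : 0 < α₂) (hE₀ : 0 ≤ E₀) (hB₃ : 0 ≤ B₃) (hB₃' : 0 ≤ B₃') (hδ₀ : 0 < δ₀)
    (hκ₀ : kappa₀ (4 * 2 ^ d) (2 * d) ≤ κ / 4)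
    (han : ∀ X, AnalyticOnNhd ℂ (EX X) (ball 0 α₂))
    (h118 : ∀ X, ∀ v ∈ ball (0 : W) α₂, ‖EX X v‖ ≤ E₀ * Real.exp (-κ * treeLen X.1))
    (hrepr : ∀ X x y, E2 X x y =
      (mixedDeriv (EX X) (h X x) (h X y)).re + (firstDeriv (EX X) (h2 X x y)).re)
    (hh : ∀ X x, ‖h X x‖ ≤ B₃ * Real.exp (-δ₀ * (geomZ d M).distD x X))
    (hh2 : ∀ X x y, ‖h2 X x y‖ ≤
      B₃' * Real.exp (-δ₀ * (geomZ d M).distD x X) * Real.exp (-δ₀ * (geomZ d M).distD y X))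
    (hsep : ∀ x ∈ Box, ∀ q ∈ Outer, R ≤ l1 (x - q)) {x : Pt d} (hx : x ∈ Box) (y : Pt d) :
    Summable (fun X : {X : LDom d // MeetsZ M Outer X} => E2 X.1 x y) ∧
    |∑' X : {X : LDom d // MeetsZ M Outer X}, E2 X.1 x y| ≤
      (4 * E₀ / α₂ ^ 2 * B₃ ^ 2 + E₀ / α₂ * B₃') * Real.exp (delta1 δ₀ κ ((M : ℝ) * d) * ((M : ℝ) * d) * 3) *
        K₀ (4 * 2 ^ d) (2 * d) * K₁ d (δ₀ / 4) *
        Real.exp (-(delta1 δ₀ κ ((M : ℝ) * d) / 2) * (R - (M : ℝ) * d * 3)) *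
        Real.exp (-(delta1 δ₀ κ ((M : ℝ) * d)) * l1 (x - y)) :=
  ineq436_latt hd hM (by positivity) hδ₀ hκ₀
    (kernelBound_of_repr43 (geomZ d M) EX h h2 E2 hα₂ hE₀ hB₃ han h118 hrepr hh hh2) hsep hx y

/-- **(5.10) ON ℤᵈ with the r = 1 term kept, FROM THE LITERAL TREE-LENGTH DECAY of p. 282** for the n(p) = 2 block
(‖h⁽²⁾_X(x, y)‖ ≤ B e^{−δ₀ℓ_X(x,y)} with ℓ_X(x, y) ≥ dist₁(x, X), dist₁(y, X)): the kernel bound then holds at site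
rate δ₀/2 (`kernelBound_of_repr43_tree`), so (4.37) converges absolutely and Π satisfies `Decay510 Π C δ₁′` with
C = (4E₀α₂⁻²B₃² + E₀α₂⁻¹B) e^{3Mdδ₁′} K₀(4·2ᵈ, 2d) K₁(d, δ₀/4) and δ₁′ = ½ min{δ₀/2, κ(Md)⁻¹} (κ ≥ 2κ₀(4·2ᵈ, 2d), δ₀ > 0).
[cite: Balaban1987RG1, p.282 and (5.10) p.293] -/
theorem decay510_latt_of_repr43_tree (hd : 0 < d) {M : ℕ} (hM : 0 < M) (EX : LDom d → W → ℂ)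
    (h : LDom d → Pt d → W) (h2 : LDom d → Pt d → Pt d → W) (E2 : LDom d → Pt d → Pt d → ℝ)
    (ℓ : LDom d → Pt d → Pt d → ℝ) {α₂ E₀ B₃ B κ δ₀ : ℝ}
    (hα₂ : 0 < α₂) (hE₀ : 0 ≤ E₀) (hB₃ : 0 ≤ B₃) (hB : 0 ≤ B) (hδ₀ : 0 < δ₀)
    (hκ₀ : kappa₀ (4 * 2 ^ d) (2 * d) ≤ κ / 2)
    (han : ∀ X, AnalyticOnNhd ℂ (EX X) (ball 0 α₂))
    (h118 : ∀ X, ∀ v ∈ ball (0 : W) α₂, ‖EX X v‖ ≤ E₀ * Real.exp (-κ * treeLen X.1))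
    (hrepr : ∀ X x y, E2 X x y =
      (mixedDeriv (EX X) (h X x) (h X y)).re + (firstDeriv (EX X) (h2 X x y)).re)
    (hh : ∀ X x, ‖h X x‖ ≤ B₃ * Real.exp (-δ₀ * (geomZ d M).distD x X))
    (hℓx : ∀ X x y, (geomZ d M).distD x X ≤ ℓ X x y) (hℓy : ∀ X x y, (geomZ d M).distD y X ≤ ℓ X x y)
    (hdec : ∀ X x y, ‖h2 X x y‖ ≤ B * Real.exp (-δ₀ * ℓ X x y)) :
    (∀ x y, Summable (fun X : LDom d => E2 X x y)) ∧
    Decay510 (fun z => ∑' X : LDom d, E2 X 0 z)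
      ((4 * E₀ / α₂ ^ 2 * B₃ ^ 2 + E₀ / α₂ * B) * Real.exp (delta1 (δ₀ / 2) κ ((M : ℝ) * d) * ((M : ℝ) * d) * 3) *
        K₀ (4 * 2 ^ d) (2 * d) * K₁ d (δ₀ / 2 / 2))
      (delta1 (δ₀ / 2) κ ((M : ℝ) * d)) := by
  have hE : (geomZ d M).KernelBound E2 (4 * E₀ / α₂ ^ 2 * B₃ ^ 2 + E₀ / α₂ * B) κ (δ₀ / 2) :=
    kernelBound_of_repr43_tree (geomZ d M) EX h h2 E2 ℓ hα₂ hE₀ hB₃ hB hδ₀.le han h118 hrepr hh hℓx hℓy hdec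
  have hCE : 0 ≤ 4 * E₀ / α₂ ^ 2 * B₃ ^ 2 + E₀ / α₂ * B := by positivity
  have hδ : 0 < δ₀ / 2 := half_pos hδ₀
  exact ⟨fun x y => (twoPoint_latt hd hM hCE hδ hκ₀ hE x y).1, decay510_latt hd hM hCE hδ hκ₀ hE⟩

/-- **(5.10) ON ℤᵈ from the full n = 2 form UNDER (4.14)**: if moreover the Fréchet derivative of each E_X at 0
vanishes (`h414`, the 𝐇-form of (4.14)), the r = 1 term is 0 in every direction, the n(p) = 2 block bound is NOT
needed, and the conclusion is literally that of `B12Ext436Lattice.decay510_latt_of_analytic` (constant 4E₀α₂⁻²B₃²,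
δ₁ = ½ min{δ₀, κ(Md)⁻¹}) — the printed route (4.14) ⇒ (4.35) ⇒ (5.10) on the infinite lattice.
[cite: Balaban1987RG1, (4.14) p.284, (4.35) p.290 and (5.10) p.293] -/
theorem decay510_latt_of_repr43_of_414 (hd : 0 < d) {M : ℕ} (hM : 0 < M) (EX : LDom d → W → ℂ)
    (h : LDom d → Pt d → W) (h2 : LDom d → Pt d → Pt d → W) (E2 : LDom d → Pt d → Pt d → ℝ)
    {α₂ E₀ B₃ κ δ₀ : ℝ} (hα₂ : 0 < α₂) (hE₀ : 0 ≤ E₀) (hB₃ : 0 ≤ B₃) (hδ₀ : 0 < δ₀)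
    (hκ₀ : kappa₀ (4 * 2 ^ d) (2 * d) ≤ κ / 2)
    (han : ∀ X, AnalyticOnNhd ℂ (EX X) (ball 0 α₂))
    (h118 : ∀ X, ∀ v ∈ ball (0 : W) α₂, ‖EX X v‖ ≤ E₀ * Real.exp (-κ * treeLen X.1))
    (h414 : ∀ X, fderiv ℂ (EX X) 0 = 0)
    (hrepr : ∀ X x y, E2 X x y =
      (mixedDeriv (EX X) (h X x) (h X y)).re + (firstDeriv (EX X) (h2 X x y)).re)
    (hh : ∀ X x, ‖h X x‖ ≤ B₃ * Real.exp (-δ₀ * (geomZ d M).distD x X)) :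
    (∀ x y, Summable (fun X : LDom d => E2 X x y)) ∧
    Decay510 (fun z => ∑' X : LDom d, E2 X 0 z)
      (4 * E₀ / α₂ ^ 2 * B₃ ^ 2 * Real.exp (delta1 δ₀ κ ((M : ℝ) * d) * ((M : ℝ) * d) * 3) *
        K₀ (4 * 2 ^ d) (2 * d) * K₁ d (δ₀ / 2))
      (delta1 δ₀ κ ((M : ℝ) * d)) :=
  decay510_latt_of_analytic hd hM EX h E2 hα₂ hE₀ hB₃ hδ₀ hκ₀ han h118
    (repr435_of_repr43 EX h h2 E2 hα₂ han h414 hrepr) hh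

/-- **(4.37)/(5.10) on 𝐃⁰_j of ℤᵈ in the SUP READING with the r = 1 term KEPT — the printed δ₁ on the nose**: with
dist(x, X), ∣x − y∣ the sup lattice distances (`geomZS`), the full n = 2 form, the analytic leaves and the p. 282 bounds
(δ₀ > 0), κ ≥ 2κ₀(4·2ᵈ, 2d): Σ_X 𝐄²(X, x, y) converges absolutely and ∣Π(x, y)∣ ≤ (4E₀α₂⁻²B₃² + E₀α₂⁻¹B₃′) e^{3Mδ₁}
K₀(4·2ᵈ, 2d) K₁(d, δ₀/(2d)) e^{−δ₁dist_∞(x,y)} with δ₁ = `delta1 δ₀ κ M` = ½ min{δ₀, κM⁻¹} — p. 293 *"(e.g., δ₁ =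
1/2min{δ₀, κM⁻¹})"* literally, the r = 1 term moving only the O(1). [cite: Balaban1987RG1, (4.37) p.291 and (5.10) p.293] -/
theorem twoPoint_lattS_of_repr43 (hd : 0 < d) {M : ℕ} (hM : 0 < M) (EX : LDom d → W → ℂ) (h : LDom d → Pt d → W)
    (h2 : LDom d → Pt d → Pt d → W) (E2 : LDom d → Pt d → Pt d → ℝ) {α₂ E₀ B₃ B₃' κ δ₀ : ℝ}
    (hα₂ : 0 < α₂) (hE₀ : 0 ≤ E₀) (hB₃ : 0 ≤ B₃) (hB₃' : 0 ≤ B₃') (hδ₀ : 0 < δ₀)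
    (hκ₀ : kappa₀ (4 * 2 ^ d) (2 * d) ≤ κ / 2)
    (han : ∀ X, AnalyticOnNhd ℂ (EX X) (ball 0 α₂))
    (h118 : ∀ X, ∀ v ∈ ball (0 : W) α₂, ‖EX X v‖ ≤ E₀ * Real.exp (-κ * treeLen X.1))
    (hrepr : ∀ X x y, E2 X x y =
      (mixedDeriv (EX X) (h X x) (h X y)).re + (firstDeriv (EX X) (h2 X x y)).re)
    (hh : ∀ X x, ‖h X x‖ ≤ B₃ * Real.exp (-δ₀ * (geomZS d M).distD x X))
    (hh2 : ∀ X x y, ‖h2 X x y‖ ≤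
      B₃' * Real.exp (-δ₀ * (geomZS d M).distD x X) * Real.exp (-δ₀ * (geomZS d M).distD y X)) (x y : Pt d) :
    Summable (fun X : LDom d => E2 X x y) ∧
    |∑' X : LDom d, E2 X x y| ≤
      (4 * E₀ / α₂ ^ 2 * B₃ ^ 2 + E₀ / α₂ * B₃') * Real.exp (delta1 δ₀ κ M * M * 3) * K₀ (4 * 2 ^ d) (2 * d) *
        K₁ d (δ₀ / 2 / d) * Real.exp (-(delta1 δ₀ κ M) * dist x y) :=
  twoPoint_lattS hd hM (by positivity) hδ₀ hκ₀
    (kernelBound_of_repr43 (geomZS d M) EX h h2 E2 hα₂ hE₀ hB₃ han h118 hrepr hh hh2) x y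

end Lattice

end Literature.MathematicalPhysics.QuantumFieldTheory.Balaban1983to89.B12Ext436R1
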